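/-
Copyright (c) 2026 the pub-hodgecm-mathlib formalisation cell (harness21).  Prover seat hodgecm-mathlib-LH7-p03 (g2): line LH7 (closer row `stub_PKtupleK2`, #181 III-127;
h413 = stmt-HodgeConjecture-24833), leaf ED. 3 road «H-SIDE CONSTRUCTION ROWS», deal (β) (LH7-plan (g3) 05:58:33Z; desk F0P3-plan (g14) D64′ «STATEMENT LAYER ONLY TONIGHT»); 2026-09-02.
-/
import Summits.HodgeConjecture.HodgeConjecture.Theorems.F0P3XiLocalCharOpenKernel    -- ★ `F0P3XiLocalCharOpenKernel.isOpen_ker_xiLocalChar`; brings ★ `Rogawski1990.XiLocalCharacter` (`OneDimAutRepH.xiLocalChar`, `localDet`, `isUnit_antidiagOne_det`), ★ `TorusCharacterLocalComponents` (`torusLocalComponent`), ★ `OneDimAutRepH`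
import Summits.HodgeConjecture.HodgeConjecture.Theorems.F0P3GlobalPacketDiscrete     -- ★ `cmOccursInDiscreteSpectrum` (generic `N`; ORGAN 2՚s currency)
import Literature.NumberTheory.Automorphic.SmoothCharacterOfCharacter               -- ★ `SmoothIrrep.ofChar` (+ §4 `IrrClass.mk_ofChar_eq_mk_ofChar_iff`)
import Literature.NumberTheory.Rogawski1990.GlobalAPacketMembership                  -- ★ `DiscreteAutomorphicRep.finRep` ∕ `Representation.smoothPart` ∕ `inclPlace` ∕ `localPiEquiv` ∕ `IrrClass.IsConstituentOf` (the body of ★ `LocalConstituentsIn`, N = 3 pattern)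
import HarnessLib

/-!
# LH7 leaf ED. 3 «H-SIDE CONSTRUCTION ROWS» — the STATEMENT LAYER on `H = U(Φ₂) × U(Φ₁)`: finite constituents and realisation of the character family
# `ξ = (η ψ) ∘ det₀ ⊠ ψ`, and the two kit-free PRINT letters O8a (strong approximation for `SU(Φ₂)`) ∕ O8b (multiplicity one for one-dimensional
# automorphic representations of `U(Φ₂)`) ([Rogawski1990] §13.3 pp. 202–203; [PlatonovRapinchuk1994] §7.4 Thm. 7.12; [Kneser1966])

Topic = the crux՚s Theorems folder; namespace `Summit.HodgeConjecture.HodgeConjecture.Cruxes.H413.F0P3cPKtupleHSideLetters`.  DEFINITIONS WITH BODIES ONLY (statement layer: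
no theorem owed, no instance, no notation, no `sorry`, no axiom); lane `--kind definition --supports stmt-HodgeConjecture-24833`.  Cell `pub/hodgecm-mathlib` (D-0151), crux H413 =
`stmt-HodgeConjecture-24833`, half A line LH7 (closer row `stub_PKtupleK2 : PKtupleLetterK2`, books #181 III-127), leaf `Cruxes/H413/Lines/F0_P3c_PKtuplePaydown.lean` ED. 2
(sorries = organs {O1′ `stub_PKtupleBaseK2` PRINT XL, O2 `stub_PKrigidCore` PRINT M}).  ROAD TO ED. 3 (LH7-plan (g2) `MEMO-ED3.v2` ad4910237d005969; LEAD F0P3a-plan (g13) T12-29;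
desk F0P3-plan (g14) D64∕D64′): un-posit the two `H`-side CONSTRUCTION rows of O1′ — (KR-2) «a.e.-character packet ⇒ character packet» and (PK-A-H♭) «`nH (ρ_ξ) = 1`» — by the
organ split O1′ ↦ O1″ + O8 + ★ glue O6∕O7, where O1″ carries IN-∃ realisation rows (KR-1′)(KD4-H)(KD5-H♭) over the currency typed HERE, and O8a∕O8b below are the kit-free print
letters the glue consumes.  THIS FILE is the (β) statement layer: the `N = 2` and `N = 1` twins of the body of ★ `Rogawski1990.LocalConstituentsIn` and the two letters, typed against
the tree՚s currency (★ `DiscreteAutomorphicRep` of `Automorphic/AutomorphicSpectrum`, ★ `finRep.smoothPart`, ★ `inclPlace` ∕ `localPiEquiv` of the `adelicGroupData` model,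
★ `cmOccursInDiscreteSpectrum` of ★ `Theorems/F0P3GlobalPacketDiscrete`, ★ `OneDimAutRepH.xiLocalChar`, ★ `torusLocalComponent` ∕ `localDet` ∕ `TorusDict`).  The split forms
`Φ₂ = antidiag(1,1)`, `Φ₁ = (1)` are spelled INLINE exactly as in ★ `LocalPacketKit.memH` and ★ `xiLocalChar` (no abbreviation is introduced).  Texts = LH7-plan (g3)՚s farm-GREEN fit
`ED3rows.fit.v4.LH7plang3.lean` f9c2a7314631e900 ll. 47–87, 120–148 verbatim up to that inlining (the three K-rows (KR-1′)(KD4-H)(KD5-H♭) stay LEAF rows and are NOT here).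

* `IsFinConstituentAt₂ P v c` ∕ `IsFinConstituentAt₁ P v c` — «`c` is a finite local constituent at `v` of the discrete automorphic `P` of `U(Φ₂)` ∕ `U(Φ₁)`»: the class `c` of the
  `cmDatum` model, transported along ★ `localPiEquiv v`, is a constituent (★ `IrrClass.IsConstituentOf`) of the smooth part of `P|_{U(𝔸_f)}` restricted along ★ `inclPlace v`.
* `Realises₂ P₂ ξ` ∕ `Realises₁ P₁ ξ` — «the finite constituents of `P₂` (resp. `P₁`) at every finite `v` are EXACTLY the class of the character `ξ_v ∘ inl = (η_v ψ_v) ∘ det₀` of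
  `U(Φ₂)(L⁺_v)` (resp. `ξ_v ∘ inr = ψ_v ∘ det` of `U(Φ₁)(L⁺_v)`)», the open-kernel witnesses being ★ `isOpen_ker_xiLocalChar` pulled back along `x ↦ (x, 1)` ∕ `u ↦ (1, u)`.
* `PKsaU2Shape L` (O8a, PRINT S, kit-free) and `PKmultOneU2Shape L` (O8b, PRINT S, kit-free) — cited PREDICATES of the CM field `L` (the leaf ED. 3 organs read
  `PKsaU2Shape L` ∕ `PKmultOneU2Shape L` at the frame՚s `L`); see their docstrings.
HONEST LABEL: statement layer only (count-neutral; books row III-127 #181 stays PRINTED∕UNPROVED under `stub_PKtupleK2`); O8a∕O8b are PRINT letters, to be cited by the leaf ED. 3 as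
sorried organs until paid; HC_CM is proved only modulo the 7 printed citations (2 remaining: hLiu418 = stmt-HodgeConjecture-24832, h413 = stmt-HodgeConjecture-24833) until rung 0 closes.

## References
* [Rogawski1990] J. D. Rogawski, *Automorphic Representations of Unitary Groups in Three Variables*, Ann. of Math. Stud. 123 (1990): §13.3 pp. 202–203 (`Π(𝐇)`, `n(ξ) = 1`,
  `m(ξ) = 1`), §12.2 pp. 173–174, §13.1 p. 199.
* [PlatonovRapinchuk1994] V. Platonov, A. Rapinchuk, *Algebraic Groups and Number Theory* (1994), §7.4 Thm. 7.12 p. 427 (strong approximation), §7.3 Prop. 7.8.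
* [Kneser1966] M. Kneser, *Strong approximation*, in: Algebraic Groups and Discontinuous Subgroups, Proc. Sympos. Pure Math. IX (1966) 187–196.
* [BorelJacquet1979] A. Borel, H. Jacquet, *Automorphic forms and automorphic representations*, Proc. Sympos. Pure Math. XXXIII.1 (1979), §4.6.
-/

set_option autoImplicit false
-- the mandated namespace repeats the single-problem summit's segment (`HodgeConjecture.HodgeConjecture`)
set_option linter.dupNamespace false

noncomputable section

namespace Summit.HodgeConjecture.HodgeConjecture.Cruxes.H413.F0P3cPKtupleHSideLetters

open MeasureTheory NumberField IsDedekindDomain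
open Literature.NumberTheory.Automorphic Literature.NumberTheory.Automorphic.UnitaryGroup
open Literature.NumberTheory.Rogawski1990 Literature.NumberTheory.GaloisRepresentations
open Literature.NumberTheory.Automorphic.Arthur2013.Leaves.TECR
open Summit.HodgeConjecture.HodgeConjecture.Cruxes.H413.F0P3GlobalPacketDiscrete

variable {L : Type} [Field L] [NumberField L] [IsCMField L]

/-! ## §1 Finite local constituents of a discrete automorphic representation of `U(Φ₂)` ∕ `U(Φ₁)` (the `N = 2, 1` twins of ★ `LocalConstituentsIn`) -/

/-- **«`c` is a finite local constituent of `P` at `v`»** for a discrete automorphic representation `P` of `U(Φ₂)` (`Φ₂ = antidiag(1,1)`, the split form of the `U(2)`-factor of the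
kit՚s `H`): the class `c` of `U(Φ₂)(L⁺_v)` in the `cmDatum` model, transported along ★ `localPiEquiv v` to the `adelicGroupData` model, is a constituent (★ `IrrClass.IsConstituentOf`:
an irreducible subquotient) of the smooth part (★ `Representation.smoothPart`) of `P|_{U(Φ₂)(𝔸_f)}` (★ `DiscreteAutomorphicRep.finRep`) restricted along ★ `inclPlace v` — the `N = 2`
twin of the body of ★ `Rogawski1990.LocalConstituentsIn`. [cite: Rogawski1990, §13.3 p. 202; §12.2 p. 173] [cite: BorelJacquet1979, §4.6] -/
def IsFinConstituentAt₂ {μ₂ : Measure (adelicGroupData (↥(maximalRealSubfield L)) L (IsCMField.complexConj L) 2 (Matrix.of fun i j : Fin 2 => if i.val + j.val + 1 = 2 then (1 : L) else 0)).automorphicQuotient} [(adelicGroupData (↥(maximalRealSubfield L)) L (IsCMField.complexConj L) 2 (Matrix.of fun i j : Fin 2 => if i.val + j.val + 1 = 2 then (1 : L) else 0)).IsAutomorphicMeasure μ₂]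
    (P : DiscreteAutomorphicRep (adelicGroupData (↥(maximalRealSubfield L)) L (IsCMField.complexConj L) 2 (Matrix.of fun i j : Fin 2 => if i.val + j.val + 1 = 2 then (1 : L) else 0)) μ₂) (v : (HeightOneSpectrum (𝓞 ↥(maximalRealSubfield L)))) (c : IrrClass ((cmDatum L 2 (Matrix.of fun i j : Fin 2 => if i.val + j.val + 1 = 2 then (1 : L) else 0)).Local v)) : Prop :=
  (IrrClass.comap (localPiEquiv L (IsCMField.complexConj L) 2 (Matrix.of fun i j : Fin 2 => if i.val + j.val + 1 = 2 then (1 : L) else 0) v) c).IsConstituentOf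
    (P.finRep.smoothPart.toRepresentation.comp (inclPlace (↥(maximalRealSubfield L)) L (IsCMField.complexConj L) 2 (Matrix.of fun i j : Fin 2 => if i.val + j.val + 1 = 2 then (1 : L) else 0) v))

/-- **«`c` is a finite local constituent of `P` at `v`»** for a discrete automorphic representation `P` of `U(Φ₁)` (`Φ₁ = (1)`, the `U(1)`-factor): the `N = 1` twin of
`IsFinConstituentAt₂`. [cite: Rogawski1990, §13.3 p. 202; §12.2 p. 173] [cite: BorelJacquet1979, §4.6] -/
def IsFinConstituentAt₁ {μ₁ : Measure (adelicGroupData (↥(maximalRealSubfield L)) L (IsCMField.complexConj L) 1 (Matrix.of fun i j : Fin 1 => if i.val + j.val + 1 = 1 then (1 : L) else 0)).automorphicQuotient} [(adelicGroupData (↥(maximalRealSubfield L)) L (IsCMField.complexConj L) 1 (Matrix.of fun i j : Fin 1 => if i.val + j.val + 1 = 1 then (1 : L) else 0)).IsAutomorphicMeasure μ₁]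
    (P : DiscreteAutomorphicRep (adelicGroupData (↥(maximalRealSubfield L)) L (IsCMField.complexConj L) 1 (Matrix.of fun i j : Fin 1 => if i.val + j.val + 1 = 1 then (1 : L) else 0)) μ₁) (v : (HeightOneSpectrum (𝓞 ↥(maximalRealSubfield L)))) (c : IrrClass ((cmDatum L 1 (Matrix.of fun i j : Fin 1 => if i.val + j.val + 1 = 1 then (1 : L) else 0)).Local v)) : Prop :=
  (IrrClass.comap (localPiEquiv L (IsCMField.complexConj L) 1 (Matrix.of fun i j : Fin 1 => if i.val + j.val + 1 = 1 then (1 : L) else 0) v) c).IsConstituentOf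
    (P.finRep.smoothPart.toRepresentation.comp (inclPlace (↥(maximalRealSubfield L)) L (IsCMField.complexConj L) 1 (Matrix.of fun i j : Fin 1 => if i.val + j.val + 1 = 1 then (1 : L) else 0) v))

/-! ## §2 Realisation of the character family `ξ_v = (ξ_v ∘ inl) ⊠ (ξ_v ∘ inr)` of `H_v = U(Φ₂)(L⁺_v) × U(Φ₁)(L⁺_v)` -/

/-- **«`P₂` REALISES the character family `ξ_v ∘ inl = (η_v ψ_v) ∘ det₀` of `U(Φ₂)` at every finite place»**: for every finite `v` the finite local constituents of `P₂` at `v` are EXACTLY the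
class of the smooth character `ξ_v ∘ inl` (★ `OneDimAutRepH.xiLocalChar` pulled back along `x ↦ (x, 1)`; open kernel by ★ `isOpen_ker_xiLocalChar`).  For a one-dimensional automorphic
`ξ = (η ψ) ∘ det₀ ⊠ ψ` of `H`, «`P₂` realises `ξ`» says `P₂` is the line `ℂ · ((η ψ) ∘ det₀)` of `L²_disc(U(Φ₂))` seen through its finite constituents. [cite: Rogawski1990, §13.3 pp. 202–203] -/
def Realises₂ {μ₂ : Measure (adelicGroupData (↥(maximalRealSubfield L)) L (IsCMField.complexConj L) 2 (Matrix.of fun i j : Fin 2 => if i.val + j.val + 1 = 2 then (1 : L) else 0)).automorphicQuotient} [(adelicGroupData (↥(maximalRealSubfield L)) L (IsCMField.complexConj L) 2 (Matrix.of fun i j : Fin 2 => if i.val + j.val + 1 = 2 then (1 : L) else 0)).IsAutomorphicMeasure μ₂]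
    (P₂ : DiscreteAutomorphicRep (adelicGroupData (↥(maximalRealSubfield L)) L (IsCMField.complexConj L) 2 (Matrix.of fun i j : Fin 2 => if i.val + j.val + 1 = 2 then (1 : L) else 0)) μ₂) (ξ : OneDimAutRepH L) : Prop :=
  ∀ (v : (HeightOneSpectrum (𝓞 ↥(maximalRealSubfield L)))) (c₂ : IrrClass ((cmDatum L 2 (Matrix.of fun i j : Fin 2 => if i.val + j.val + 1 = 2 then (1 : L) else 0)).Local v)),
    IsFinConstituentAt₂ P₂ v c₂ ↔
      c₂ = IrrClass.mk (SmoothIrrep.ofChar ((ξ.xiLocalChar v).comp (MonoidHom.inl _ _))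
        ((F0P3XiLocalCharOpenKernel.isOpen_ker_xiLocalChar L ξ v).preimage (Continuous.prodMk_left 1)))

/-- **«`P₁` REALISES the character family `ξ_v ∘ inr = ψ_v ∘ det` of `U(Φ₁)` at every finite place»** (the `U(1)`-factor twin of `Realises₂`; pull-back along `u ↦ (1, u)`).
[cite: Rogawski1990, §13.3 pp. 202–203] -/
def Realises₁ {μ₁ : Measure (adelicGroupData (↥(maximalRealSubfield L)) L (IsCMField.complexConj L) 1 (Matrix.of fun i j : Fin 1 => if i.val + j.val + 1 = 1 then (1 : L) else 0)).automorphicQuotient} [(adelicGroupData (↥(maximalRealSubfield L)) L (IsCMField.complexConj L) 1 (Matrix.of fun i j : Fin 1 => if i.val + j.val + 1 = 1 then (1 : L) else 0)).IsAutomorphicMeasure μ₁]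
    (P₁ : DiscreteAutomorphicRep (adelicGroupData (↥(maximalRealSubfield L)) L (IsCMField.complexConj L) 1 (Matrix.of fun i j : Fin 1 => if i.val + j.val + 1 = 1 then (1 : L) else 0)) μ₁) (ξ : OneDimAutRepH L) : Prop :=
  ∀ (v : (HeightOneSpectrum (𝓞 ↥(maximalRealSubfield L)))) (c₁ : IrrClass ((cmDatum L 1 (Matrix.of fun i j : Fin 1 => if i.val + j.val + 1 = 1 then (1 : L) else 0)).Local v)),
    IsFinConstituentAt₁ P₁ v c₁ ↔
      c₁ = IrrClass.mk (SmoothIrrep.ofChar ((ξ.xiLocalChar v).comp (MonoidHom.inr _ _))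
        ((F0P3XiLocalCharOpenKernel.isOpen_ker_xiLocalChar L ξ v).preimage (Continuous.prodMk_right 1)))

/-! ## §3 The two kit-free PRINT letters O8a ∕ O8b (cited PREDICATES of the CM field `L`: the gate keeps parametrised cited `Prop` defs in Theorems, cf. ★ `cmOccursInDiscreteSpectrum`;
a closed form would be relocated to `Literature/` where `Realises₂` ∕ ★ `cmOccursInDiscreteSpectrum` are not importable — gate bounce p849764∕p849765 of v2) -/

end Summit.HodgeConjecture.HodgeConjecture.Cruxes.H413.F0P3cPKtupleHSideLetters

namespace Summit.HodgeConjecture.HodgeConjecture.Cruxes.H413.F0P3cPKtupleHSideLetters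

open MeasureTheory NumberField IsDedekindDomain
open Literature.NumberTheory.Automorphic Literature.NumberTheory.Automorphic.UnitaryGroup
open Literature.NumberTheory.Rogawski1990 Literature.NumberTheory.GaloisRepresentations
open Literature.NumberTheory.Automorphic.Arthur2013.Leaves.TECR
open Summit.HodgeConjecture.HodgeConjecture.Cruxes.H413.F0P3GlobalPacketDiscrete


/-- **O8a `PKsaU2Shape` (PRINT S, KIT-FREE) — GLOBALISATION OF CHARACTERS ∕ STRONG APPROXIMATION FOR `SU(Φ₂)_{L∕L⁺} ≅ SL₂`**: «a family `π₂ = (π₂,v)_v` of classes of the quasi-split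
`U(Φ₂)(L⁺_v)` OCCURRING in the discrete spectrum of an automorphic measure `μ₂` (★ `cmOccursInDiscreteSpectrum`, `N = 2`) whose members are one-dimensional at ALMOST ALL finite places
(the cofinite quantifier `∀ᶠ v in Filter.cofinite` is EXPLICIT) is, at EVERY finite place, the class of the character `θ_v ∘ det` of ONE automorphic character `θ` of the norm-one torus
`T = U(1)_{L∕L⁺}` (★ `TorusDict.torus`, ★ `torusLocalComponent`, ★ `localDet`)».  WHY TRUE IN PRINT (LEAD F0P3a-plan (g13) T12-29 (ii), the docstring note of record): the realising
discrete `τ = ⊗ τ_v` has `τ_v` one-dimensional, hence trivial on `SU(Φ₂)(L⁺_v) ≅ SL₂(L⁺_v)` (no non-trivial characters), for every `v` in the COFINITE set `S` of finite places outside the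
exceptional finite set; `S` contains the infinitely many places of `L⁺` that SPLIT in `L`, where `SU(Φ₂) ≅ SL₂` is isotropic, so `SU(Φ₂)_S` is NON-COMPACT and STRONG APPROXIMATION for the simply
connected `SU(Φ₂)` [PlatonovRapinchuk1994 §7.4 Thm. 7.12 p. 427; Kneser1966] makes `SU(Φ₂)(L⁺)·SU(Φ₂)_S` dense in `SU(Φ₂)(𝔸_f)`; a vector of `τ` that is left-`U(Φ₂)(L⁺)`-invariant and
right-`SU(Φ₂)_S`-invariant is then `SU(Φ₂)(𝔸_f)`-invariant, so `τ` factors through `det : U(Φ₂) → T` and is the character `θ ∘ det` of an automorphic `θ` (★ `U(1)` multiplicity one,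
`AdelicCommutativeDatumMultiplicityOne`) — at EVERY finite place.  The ARCHIMEDEAN places are NOT used (for `Φ₂` they are `U(1,1)`; the argument runs at the finite places only).  Consumed by the in-house glue O6 of the
leaf ED. 3 together with ★ p848635 `OneDimAutRepH.ext_of_eventually_xiLocalChar_eq`. [cite: PlatonovRapinchuk1994, §7.4 Thm. 7.12 p. 427] [cite: Kneser1966, Hauptsatz]
[cite: Rogawski1990, §13.3 pp. 202–203] -/
def PKsaU2Shape (L : Type) [Field L] [NumberField L] [IsCMField L] : Prop :=
  ∀ (μ₂ : Measure (adelicGroupData (↥(maximalRealSubfield L)) L (IsCMField.complexConj L) 2 (Matrix.of fun i j : Fin 2 => if i.val + j.val + 1 = 2 then (1 : L) else 0)).automorphicQuotient) [(adelicGroupData (↥(maximalRealSubfield L)) L (IsCMField.complexConj L) 2 (Matrix.of fun i j : Fin 2 => if i.val + j.val + 1 = 2 then (1 : L) else 0)).IsAutomorphicMeasure μ₂]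
    (π₂ : ∀ v : (HeightOneSpectrum (𝓞 ↥(maximalRealSubfield L))), IrrClass ((cmDatum L 2 (Matrix.of fun i j : Fin 2 => if i.val + j.val + 1 = 2 then (1 : L) else 0)).Local v)),
    cmOccursInDiscreteSpectrum L 2 (Matrix.of fun i j : Fin 2 => if i.val + j.val + 1 = 2 then (1 : L) else 0) μ₂ π₂ →
    (∀ᶠ v : (HeightOneSpectrum (𝓞 ↥(maximalRealSubfield L))) in Filter.cofinite,
        ∃ (χ : ((cmDatum L 2 (Matrix.of fun i j : Fin 2 => if i.val + j.val + 1 = 2 then (1 : L) else 0)).Local v) →* ℂˣ) (hχ : IsOpen ((χ.ker : Subgroup ((cmDatum L 2 (Matrix.of fun i j : Fin 2 => if i.val + j.val + 1 = 2 then (1 : L) else 0)).Local v)) : Set ((cmDatum L 2 (Matrix.of fun i j : Fin 2 => if i.val + j.val + 1 = 2 then (1 : L) else 0)).Local v))),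
          π₂ v = IrrClass.mk (SmoothIrrep.ofChar χ hχ)) →
      ∃ (θ : ↥(TorusDict.torus (IsCMField.complexConj L)) →ₜ* ℂˣ) (_ : TorusDict.IsAutomorphic (IsCMField.complexConj L) θ)
        (hk : ∀ v : (HeightOneSpectrum (𝓞 ↥(maximalRealSubfield L))),
          IsOpen (((((torusLocalComponent L (IsCMField.complexConj L) v θ).comp (localDet (IsCMField.complexConj L) v (isUnit_antidiagOne_det L 2))).ker :
            Subgroup ↥(«local» L (IsCMField.complexConj L) 2 (Matrix.of fun i j : Fin 2 => if i.val + j.val + 1 = 2 then (1 : L) else 0) v)) : Set ↥(«local» L (IsCMField.complexConj L) 2 (Matrix.of fun i j : Fin 2 => if i.val + j.val + 1 = 2 then (1 : L) else 0) v)))),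
        ∀ v : (HeightOneSpectrum (𝓞 ↥(maximalRealSubfield L))),
          π₂ v = IrrClass.mk (SmoothIrrep.ofChar
            ((torusLocalComponent L (IsCMField.complexConj L) v θ).comp (localDet (IsCMField.complexConj L) v (isUnit_antidiagOne_det L 2))) (hk v))

/-- **O8b `PKmultOneU2Shape` (PRINT S, KIT-FREE) — MULTIPLICITY ONE FOR ONE-DIMENSIONAL AUTOMORPHIC REPRESENTATIONS OF `U(Φ₂)`**: «two discrete automorphic representations `P₂, P₂′`
of `U(Φ₂)` realising the same character family `ξ_v ∘ inl` at every finite place COINCIDE (both are the line `ℂ · (η ψ) ∘ det₀` of `L²_disc(U(Φ₂))`)» [Rogawski1990 §13.3 p. 203 «`m(ξ) = 1`»;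
in print: strong approximation (O8a) makes both lines `θ ∘ det`-isotypic with the same automorphic `θ`, and a `θ ∘ det`-eigenfunction on `U(Φ₂)(L⁺)\U(Φ₂)(𝔸)` is a constant multiple of
`θ ∘ det` (the argument of ★ `closedSubrep_eq_of_finrank_eq_one` ∕ ★ `hasMultiplicityOne_rightRegular_cmDatum_one`)].  Consumed by the in-house glue O7 of the leaf ED. 3 (with the
`U(1)` twin over ★ `AdelicCommutativeDatumMultiplicityOne`) to derive «`nH (ρ_ξ) = 1`». [cite: Rogawski1990, §13.3 p. 203] [cite: PlatonovRapinchuk1994, §7.4 Thm. 7.12 p. 427] -/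
def PKmultOneU2Shape (L : Type) [Field L] [NumberField L] [IsCMField L] : Prop :=
  ∀ (μ₂ : Measure (adelicGroupData (↥(maximalRealSubfield L)) L (IsCMField.complexConj L) 2 (Matrix.of fun i j : Fin 2 => if i.val + j.val + 1 = 2 then (1 : L) else 0)).automorphicQuotient) [(adelicGroupData (↥(maximalRealSubfield L)) L (IsCMField.complexConj L) 2 (Matrix.of fun i j : Fin 2 => if i.val + j.val + 1 = 2 then (1 : L) else 0)).IsAutomorphicMeasure μ₂] (ξ : OneDimAutRepH L)
    (P₂ P₂' : DiscreteAutomorphicRep (adelicGroupData (↥(maximalRealSubfield L)) L (IsCMField.complexConj L) 2 (Matrix.of fun i j : Fin 2 => if i.val + j.val + 1 = 2 then (1 : L) else 0)) μ₂), Realises₂ P₂ ξ → Realises₂ P₂' ξ → P₂ = P₂'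

end Summit.HodgeConjecture.HodgeConjecture.Cruxes.H413.F0P3cPKtupleHSideLetters
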